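import Literature.NumberTheory.EllipticCurves.PAdicLFunctionTameConvergenceProofs
import HarnessLib

/-!
# Matsuno 2000, Lemma 3.2 at tame level `m` IN THE KERNEL (the analytic core): congruent characters have congruent
# transforms — `‖[T^k] L_p(f,α,χ) − [T^k] L_p(f,α,χ')‖ ≤ (sup_b ‖χ(b) − χ'(b)‖) · (sup ‖μ_{f,α,m}‖)` (PROOFS ONLY)

Cell bsd-2adic, seat conv-1 (planner RULING RC-159 road P3, analytic half). K. Matsuno, J. Number Theory 84 (2000), Lemma 3.2
(p. 87): "Since `ψ` has a `p`-power order, `ψ(x)` is congruent to `1` modulo `π` for any `x ∈ ℤ_{p,m}^×`. Hence we have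
`G_{p,m}(E, φψ, T) ≡ G_{p,m}(E, φ, T) (mod π)`." The argument is termwise on the Riemann sums and passes to the limit; here it is
written SCALE-FREE for the tree's tame `χ`-twisted `p`-adic `L`-function (`PAdicLFunctionTame`): if two `ℚ_p`-valued Dirichlet
characters mod `m` satisfy `‖χ(b) − χ'(b)‖ ≤ ε` for all `b`, and the tame measure satisfies `‖μ_{f,α,m}((a + pⁿℤ_p) × {b})‖ ≤ C`, then
every coefficient of `L_p(f,α,χ) − L_p(f,α,χ')` has norm `≤ ε·C` (ultrametric estimate of the Riemann sums, `‖(s choose k)‖ ≤ 1`,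
limits by `tendsto_padicLRiemannSumTame_holds`). At `p = 2`, `χ = χ_d` (values `±1`), `χ' = 𝟙_d`: `ε = ‖2‖ = ½`, so at an INTEGRAL
scale (`C ≤ 1`) the two functions are congruent modulo `2` — the analytic input of the cell's congruence `hcong`
(`Summits/…/Theorems/TwoAdicConverseKidaAnalyticOfCongruence.lean`); the arithmetic of the scale (which `C`, `μ = 0`) is NOT done here.

References: K. Matsuno, J. Number Theory 84 (2000), Lemma 3.2 (p. 87) [Matsuno2000]; B. Mazur, J. Tate, J. Teitelbaum, Invent. Math.
84 (1986), §I.11–I.13 [MazurTateTeitelbaum1986Invent].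
-/

noncomputable section

open scoped MatrixGroups ModularForm

open CongruenceSubgroup Filter Topology Literature.NumberTheory.EllipticCurves.ModularForms

namespace Literature.NumberTheory.EllipticCurves

section Congruence

variable {N : ℕ} [NeZero N] (f : CuspForm (Gamma0 N) 2) {p : ℕ} [Fact p.Prime] {m : ℕ} [NeZero m]

omit [NeZero N] in
/-- **Termwise estimate** (Matsuno 2000, proof of Lemma 3.2): if `‖χ(b) − χ'(b)‖ ≤ ε` for all `b mod m` and
`‖μ_{f,α,m}‖ ≤ C`, the level-`n` Riemann sums of `L_p(f,α,χ)` and `L_p(f,α,χ')` differ by at most `ε·C` (ultrametric).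
[cite: Matsuno2000, Lemma 3.2 (p. 87), proof] -/
theorem norm_padicLRiemannSumTame_sub_le (α : ℚ_[p]) (χ χ' : DirichletCharacter ℚ_[p] m) {ε : ℝ} (hε : 0 ≤ ε)
    (hχ : ∀ b : ZMod m, ‖χ b - χ' b‖ ≤ ε) {C : ℝ} (hC0 : 0 ≤ C)
    (hC : ∀ (n : ℕ) (a : ZMod (p ^ n)) (b : ZMod m), ‖msdMeasureTame f m α n a b‖ ≤ C) (k n : ℕ) :
    ‖padicLRiemannSumTame f m α χ k n - padicLRiemannSumTame f m α χ' k n‖ ≤ ε * C := by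
  classical
  haveI := neZero_torsionOrder p
  haveI := Fintype.ofFinite (rootsOfUnity (torsionOrder p) ℤ_[p])
  unfold padicLRiemannSumTame
  rw [finsum_eq_sum_of_fintype, finsum_eq_sum_of_fintype, ← Finset.sum_sub_distrib]
  refine IsUltrametricDist.norm_sum_le_of_forall_le_of_nonneg (by positivity) fun z _ ↦ ?_
  rw [← Finset.sum_sub_distrib]
  refine IsUltrametricDist.norm_sum_le_of_forall_le_of_nonneg (by positivity) fun s _ ↦ ?_
  rw [← Finset.sum_sub_distrib]
  refine IsUltrametricDist.norm_sum_le_of_forall_le_of_nonneg (by positivity) fun b _ ↦ ?_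
  rw [← sub_mul, ← sub_mul, norm_mul, norm_mul]
  have hk : ‖((s.val.choose k : ℕ) : ℚ_[p])‖ ≤ 1 := by exact_mod_cast Padic.norm_int_le_one (p := p) (s.val.choose k : ℕ)
  calc ‖χ b - χ' b‖ * ‖msdMeasureTame f m α _ _ b‖ * ‖((s.val.choose k : ℕ) : ℚ_[p])‖ ≤ ε * C * 1 :=
        mul_le_mul (mul_le_mul (hχ b) (hC _ _ b) (norm_nonneg _) hε) hk (norm_nonneg _) (by positivity)
    _ = ε * C := mul_one _

/-- **Matsuno 2000, Lemma 3.2 at tame level (scale-free form).** For a rational normalised newform `f` of level `N` prime to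
`p`, `(m, p) = 1`, `α` the unit root, and two `ℚ_p`-valued Dirichlet characters mod `m` with `‖χ(b) − χ'(b)‖ ≤ ε` for all `b`:
if `‖μ_{f,α,m}‖ ≤ C` then every coefficient satisfies `‖[T^k] L_p(f,α,χ) − [T^k] L_p(f,α,χ')‖ ≤ ε·C`. At `p = 2`, `χ = χ_d`,
`χ' = 𝟙_d`, `ε = ½`: the two transforms are congruent modulo `2` at any integral scale.
[cite: Matsuno2000, Lemma 3.2 (p. 87)] [cite: MazurTateTeitelbaum1986Invent, §I.11–I.13 (pp. 13–19)] -/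
theorem norm_padicLCoeffTame_sub_le (hf : IsNewform0 f) (hQ : coeffField f = ⊥) (hpN : ¬ p ∣ N) (hmp : m.Coprime p)
    {ap : ℤ} (hap : cuspCoeff f p = ap) {α : ℚ_[p]} (hα : α ^ 2 - ap * α + p = 0) (hαu : ‖α‖ = 1)
    (χ χ' : DirichletCharacter ℚ_[p] m) {ε : ℝ} (hε : 0 ≤ ε) (hχ : ∀ b : ZMod m, ‖χ b - χ' b‖ ≤ ε) {C : ℝ} (hC0 : 0 ≤ C)
    (hC : ∀ (n : ℕ) (a : ZMod (p ^ n)) (b : ZMod m), ‖msdMeasureTame f m α n a b‖ ≤ C) (k : ℕ) :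
    ‖padicLCoeffTame f m α χ k - padicLCoeffTame f m α χ' k‖ ≤ ε * C := by
  have h1 := tendsto_padicLRiemannSumTame_holds hf hQ hpN hmp hap hα hαu χ k
  have h2 := tendsto_padicLRiemannSumTame_holds hf hQ hpN hmp hap hα hαu χ' k
  exact le_of_tendsto (h1.sub h2).norm (Eventually.of_forall fun n ↦
    norm_padicLRiemannSumTame_sub_le f α χ χ' hε hχ hC0 hC k n)

/-- **The characters of the application: `‖χ(b) − 𝟙(b)‖ ≤ ‖2‖` for a QUADRATIC character** (`χ² = 1`: on units `χ(b) = ±1`,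
and `1 − (−1) = 2`; off units both vanish) — Matsuno's "`ψ(x) ≡ 1 (mod π)`" at `p = 2`, `ψ = χ_d`.
[cite: Matsuno2000, Lemma 3.2 (p. 87), proof] -/
theorem norm_sub_one_apply_le_of_sq_eq_one (χ : DirichletCharacter ℚ_[p] m) (hχ : χ ^ 2 = 1) (b : ZMod m) :
    ‖χ b - (1 : DirichletCharacter ℚ_[p] m) b‖ ≤ ‖(2 : ℚ_[p])‖ := by
  by_cases hb : IsUnit b
  · obtain ⟨u, rfl⟩ := hb
    rw [MulChar.one_apply_coe]
    have hsq : (χ u) ^ 2 = 1 := by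
      have := congrArg (fun ψ : DirichletCharacter ℚ_[p] m ↦ ψ (u : ZMod m)) hχ
      simpa [pow_two, MulChar.mul_apply] using this
    have hsq' : χ (u : ZMod m) * χ (u : ZMod m) = 1 := by rw [← pow_two]; exact hsq
    rcases mul_self_eq_one_iff.mp hsq' with h | h
    · rw [h, sub_self, norm_zero]; exact norm_nonneg _
    · rw [h, show (-1 : ℚ_[p]) - 1 = -2 by norm_num, norm_neg]
  · rw [χ.map_nonunit hb, MulChar.map_nonunit _ hb, sub_self, norm_zero]
    exact norm_nonneg _

end Congruence

end Literature.NumberTheory.EllipticCurves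

end
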